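import Summits.RiemannHypothesis.RiemannHypothesis.Theorems.ScrewLemmaKExtremalRayDefs
import Summits.RiemannHypothesis.RiemannHypothesis.Theorems.ScrewLemmaKCoprofileMellin
import HarnessLib

/-!
# Route `ScrewLemmaKExtremalRay`, crux E1 (`NearExtremalGenerators`, stmt-RiemannHypothesis-22262):
# real moments of the dilation operator and `L²(0,1)` bookkeeping

Two inputs of piece (b) (`ScrewLemmaKExtremalRayApprox`, polynomial `L²`-approximants of the Möbius
generator with the two admissibility moments):

* `latticeCoprofile_moment_of_bound` / `coprofileOp_polynomial_moment` — the REAL MOMENTS of the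
  co-profile, `∫_{(0,1)} (A ψ)(t) t^a dt = Re ζ(a+2) · ∫₀¹ ψ(u) u^a du` (`a ≥ 0`), for every generator
  with bounded derivative resp. every polynomial `ψ` (Müntz's formula in the half-plane of absolute
  convergence, tree `ScrewLemmaKCoprofile.mellin_latticeCoprofile_eq`; the tree's
  `latticeCoprofile_moment` is the admissible special case), and `riemannZeta_re_ne_zero`;
* `integrableOn_sq_of_bound`, `integrableOn_sq_polynomial`, `abs_setIntegral_mul_le_sqrt` —
  square-integrability on `(0,1)` and the Cauchy–Schwarz inequality
  `|∫_{(0,1)} f w| ≤ √(∫f²) √(∫w²)` (Mathlib Hölder `integral_mul_norm_le_Lp_mul_Lq`).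

RH-free real analysis; nothing here bears on the truth of RH.
-/

set_option linter.dupNamespace false

noncomputable section

namespace Summit.RiemannHypothesis.RiemannHypothesis.Theorems.ScrewLemmaKExtremalRay

open MeasureTheory Set Filter Polynomial
open Summit.RiemannHypothesis.RiemannHypothesis.Theorems.ScrewLemmaKCoprofile
  (latticeCoprofile mellin_latticeCoprofile_eq latticeCoprofile_eq_zero_of_one_lt)

/-! ### §1 Real moments of the co-profile for generators with bounded derivative -/

/-- Real moments through the Mellin formula, for ANY generator whose derivative is bounded on
`(0,1)` (the tree's `latticeCoprofile_moment` is the admissible special case):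
`∫_{(0,1)} Φ_g(t) t^a dt = Re ζ(a+2) · ∫₀¹ g′(u) u^a du` for real `a ≥ 0`.
[cite: Titchmarsh1986, §2.11] -/
theorem latticeCoprofile_moment_of_bound {g : ℝ → ℝ} {B : ℝ}
    (hB : ∀ u ∈ Set.Ioo (0:ℝ) 1, |deriv g u| ≤ B) {a : ℝ} (ha : 0 ≤ a) :
    ∫ t in Set.Ioo (0:ℝ) 1, latticeCoprofile g t * t ^ a
      = (riemannZeta ((a : ℂ) + 2)).re * ∫ u in (0:ℝ)..1, deriv g u * u ^ a := by
  have hs : 1 < ((a : ℂ) + 2).re := by simp; linarith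
  obtain ⟨_, hM⟩ := mellin_latticeCoprofile_eq hB hs
  have hL : mellin (fun t => ((latticeCoprofile g t : ℝ) : ℂ)) ((a : ℂ) + 2 - 1)
      = (((∫ t in Set.Ioo (0:ℝ) 1, latticeCoprofile g t * t ^ a) : ℝ) : ℂ) := by
    unfold mellin
    rw [setIntegral_eq_of_subset_of_forall_sdiff_eq_zero measurableSet_Ioi Set.Ioc_subset_Ioi_self
      ?_, integral_Ioc_eq_integral_Ioo, ← integral_complex_ofReal]
    · refine setIntegral_congr_fun measurableSet_Ioo fun t ht => ?_
      rw [show (a : ℂ) + 2 - 1 - 1 = (a : ℂ) by ring, ← Complex.ofReal_cpow ht.1.le, smul_eq_mul]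
      push_cast
      ring
    · intro t ht
      have h1 : 1 < t := by
        rcases ht with ⟨h0, hn⟩
        by_contra h
        exact hn ⟨h0, not_lt.mp h⟩
      simp [latticeCoprofile_eq_zero_of_one_lt h1]
  have hR : (∫ u in Set.Ioo (0:ℝ) 1, ((deriv g u : ℝ) : ℂ) * (u : ℂ) ^ ((a : ℂ) + 2 - 2))
      = (((∫ u in (0:ℝ)..1, deriv g u * u ^ a) : ℝ) : ℂ) := by
    rw [intervalIntegral.integral_of_le zero_le_one, integral_Ioc_eq_integral_Ioo,
      ← integral_complex_ofReal]
    refine setIntegral_congr_fun measurableSet_Ioo fun u hu => ?_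
    rw [show (a : ℂ) + 2 - 2 = (a : ℂ) by ring, ← Complex.ofReal_cpow hu.1.le]
    push_cast
    ring
  rw [hL, hR] at hM
  have hz : riemannZeta ((a : ℂ) + 2) = (((riemannZeta ((a : ℂ) + 2)).re : ℝ) : ℂ) := by
    have hreal : (starRingEnd ℂ) ((a : ℂ) + 2) = (a : ℂ) + 2 := by
      apply Complex.ext <;> simp
    have h := riemannZeta_conj ((a : ℂ) + 2)
    rw [hreal] at h
    exact (Complex.conj_eq_iff_re.mp h.symm).symm
  rw [hz] at hM
  exact_mod_cast hM

/-- `Re ζ(a+2) ≠ 0` for real `a ≥ 0` (`ζ` has no zeros in `Re s > 1` and is real on the real axis).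
[folklore] -/
theorem riemannZeta_re_ne_zero {a : ℝ} (ha : 0 ≤ a) : (riemannZeta ((a : ℂ) + 2)).re ≠ 0 := by
  have hs : 1 < ((a : ℂ) + 2).re := by simp; linarith
  have hne := riemannZeta_ne_zero_of_one_lt_re hs
  have hz : riemannZeta ((a : ℂ) + 2) = (((riemannZeta ((a : ℂ) + 2)).re : ℝ) : ℂ) := by
    have hreal : (starRingEnd ℂ) ((a : ℂ) + 2) = (a : ℂ) + 2 := by
      apply Complex.ext <;> simp
    have h := riemannZeta_conj ((a : ℂ) + 2)
    rw [hreal] at h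
    exact (Complex.conj_eq_iff_re.mp h.symm).symm
  intro h0
  apply hne
  rw [hz, h0]
  simp

/-- Moments of `A q` for a POLYNOMIAL `q` (applied to the primitive `g(u) = ∫₀^u q`, whose
derivative is `q` everywhere): `∫_{(0,1)} (A q)(t) t^a dt = Re ζ(a+2) · ∫₀¹ q(u) u^a du`, `a ≥ 0`.
[folklore] -/
theorem coprofileOp_polynomial_moment (q : ℝ[X]) {a : ℝ} (ha : 0 ≤ a) :
    ∫ t in Set.Ioo (0:ℝ) 1, coprofileOp (fun u => q.eval u) t * t ^ a
      = (riemannZeta ((a : ℂ) + 2)).re * ∫ u in (0:ℝ)..1, q.eval u * u ^ a := by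
  set g : ℝ → ℝ := fun u => ∫ x in (0:ℝ)..u, q.eval x with hg
  have hderiv : deriv g = fun u => q.eval u := by
    funext u
    exact Continuous.deriv_integral _ q.continuous 0 u
  obtain ⟨B, hB⟩ := isCompact_Icc.exists_bound_of_continuousOn
    (q.continuous.continuousOn : ContinuousOn (fun u => q.eval u) (Set.Icc (0:ℝ) 1))
  have hB' : ∀ u ∈ Set.Ioo (0:ℝ) 1, |deriv g u| ≤ B := fun u hu => by
    rw [hderiv, ← Real.norm_eq_abs]
    exact hB u (Set.Ioo_subset_Icc_self hu)
  have h := latticeCoprofile_moment_of_bound hB' ha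
  rw [latticeCoprofile_eq_coprofileOp, hderiv] at h
  exact h

/-! ### §2 Square-integrability bookkeeping on `(0,1)` -/

/-- `(0,1)` has Lebesgue measure one, so its restriction is a finite measure. [folklore] -/
theorem isFiniteMeasure_restrict_Ioo : IsFiniteMeasure (volume.restrict (Set.Ioo (0:ℝ) 1)) :=
  isFiniteMeasure_restrict.mpr (by simp)

/-- A bounded measurable function is in `L²(0,1)` (integrable square). [folklore] -/
theorem integrableOn_sq_of_bound {f : ℝ → ℝ} (hf : Measurable f) {C : ℝ}
    (hC : ∀ u ∈ Set.Ioo (0:ℝ) 1, |f u| ≤ C) :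
    IntegrableOn (fun u => f u ^ 2) (Set.Ioo (0:ℝ) 1) := by
  haveI := isFiniteMeasure_restrict_Ioo
  have hm : MemLp f 2 (volume.restrict (Set.Ioo (0:ℝ) 1)) :=
    MemLp.of_bound hf.aestronglyMeasurable C
      ((ae_restrict_mem measurableSet_Ioo).mono fun u hu => by
        rw [Real.norm_eq_abs]; exact hC u hu)
  exact (memLp_two_iff_integrable_sq hf.aestronglyMeasurable).mp hm

/-- A polynomial has integrable square on `(0,1)`. [folklore] -/
theorem integrableOn_sq_polynomial (q : ℝ[X]) :
    IntegrableOn (fun u => q.eval u ^ 2) (Set.Ioo (0:ℝ) 1) := by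
  obtain ⟨B, hB⟩ := isCompact_Icc.exists_bound_of_continuousOn
    (q.continuous.continuousOn : ContinuousOn (fun u => q.eval u) (Set.Icc (0:ℝ) 1))
  exact integrableOn_sq_of_bound q.continuous.measurable fun u hu => by
    rw [← Real.norm_eq_abs]; exact hB u (Set.Ioo_subset_Icc_self hu)

/-- CAUCHY–SCHWARZ on `(0,1)` in the form used: `|∫_{(0,1)} f·w| ≤ √(∫ f²) · √(∫ w²)` for
measurable `f, w` with integrable squares. [folklore] -/
theorem abs_setIntegral_mul_le_sqrt {f w : ℝ → ℝ} (hf : Measurable f) (hw : Measurable w)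
    (hf2 : IntegrableOn (fun u => f u ^ 2) (Set.Ioo (0:ℝ) 1))
    (hw2 : IntegrableOn (fun u => w u ^ 2) (Set.Ioo (0:ℝ) 1)) :
    |∫ t in Set.Ioo (0:ℝ) 1, f t * w t|
      ≤ Real.sqrt (∫ t in Set.Ioo (0:ℝ) 1, f t ^ 2) * Real.sqrt (∫ t in Set.Ioo (0:ℝ) 1, w t ^ 2) := by
  set μ : Measure ℝ := volume.restrict (Set.Ioo (0:ℝ) 1) with hμ
  have hfm : MemLp f (ENNReal.ofReal 2) μ := by
    rw [show ENNReal.ofReal 2 = 2 by norm_num]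
    exact (memLp_two_iff_integrable_sq hf.aestronglyMeasurable).mpr hf2
  have hwm : MemLp w (ENNReal.ofReal 2) μ := by
    rw [show ENNReal.ofReal 2 = 2 by norm_num]
    exact (memLp_two_iff_integrable_sq hw.aestronglyMeasurable).mpr hw2
  have h := integral_mul_norm_le_Lp_mul_Lq (μ := μ) Real.HolderConjugate.two_two hfm hwm
  have e1 : (∫ t, ‖f t‖ ^ (2:ℝ) ∂μ) = ∫ t, f t ^ 2 ∂μ :=
    integral_congr_ae (ae_of_all _ fun t => by
      simp only [Real.norm_eq_abs, Real.rpow_two, sq_abs])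
  have e2 : (∫ t, ‖w t‖ ^ (2:ℝ) ∂μ) = ∫ t, w t ^ 2 ∂μ :=
    integral_congr_ae (ae_of_all _ fun t => by
      simp only [Real.norm_eq_abs, Real.rpow_two, sq_abs])
  rw [e1, e2, show (1:ℝ) / 2 = 1 / 2 from rfl] at h
  have h2 : |∫ t, f t * w t ∂μ| ≤ ∫ t, ‖f t‖ * ‖w t‖ ∂μ := by
    calc |∫ t, f t * w t ∂μ| ≤ ∫ t, |f t * w t| ∂μ := abs_integral_le_integral_abs
      _ = ∫ t, ‖f t‖ * ‖w t‖ ∂μ :=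
          integral_congr_ae (ae_of_all _ fun t => by
            simp only [Real.norm_eq_abs, abs_mul])
  rw [Real.sqrt_eq_rpow, Real.sqrt_eq_rpow]
  exact h2.trans h

end Summit.RiemannHypothesis.RiemannHypothesis.Theorems.ScrewLemmaKExtremalRay

end
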